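import Summits.ValiantsHypothesis.ValiantsHypothesis.Theorems.SymPencilSingFiveLeafRowsTools

/-!
# Route `SymPencil` — the V-side of the size-27 cell `(11, 5, 4)`, PORT of val-idea-18's cascade, leaf R1N: `n_r = 4` and the normal form
# (`--supports` stmt-ValiantsHypothesis-5674 `SdcSuperquadratic`; verbatim port of §2h (second half) of
# `Cruxes/SdcSuperquadratic/Lines/sing_five_classification.lean` rev 10 (val-idea-18 g5); PORT-PLAN-115.md; rung currency only)

`common_col_gen` ((T1′) for a general row pair), `nr4_false` (memo §6.3 (B3): no live row of full rank `4`), `polar₁` ((T2)), and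
`threeRowsFourCols_of_residual`: leaf R1N (`stub_threeRowsFourCols`: one zero row, no zero column, `¬ TwoZeroRows`, `¬ InCross`,
`PerDirFour`) follows from the RESIDUAL in normal form (zero row `3`, no live row of rank `4`).

Honest framing: [folklore] a verbatim port; `27 ≤ sdc(per₄) ≤ 29` unchanged; the crux `SdcSuperquadratic` and `VP ≠ VNP` untouched; no summit
statement is proved here.  No definitions, no named facts.
-/

noncomputable section

-- single-conjunct layout: Sub = Summit, duplicated namespace component intended
set_option linter.dupNamespace false

namespace Summit.ValiantsHypothesis.ValiantsHypothesis.Theorems.SymPencilSingFiveClassification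

open MvPolynomial Module Matrix
open scoped Polynomial
open Literature.Computability.AlgebraicComplexity
open Summit.ValiantsHypothesis.ValiantsHypothesis.Theorems
open Summit.ValiantsHypothesis.ValiantsHypothesis.Theorems.SymPencilSingSixClassification
open Summit.ValiantsHypothesis.ValiantsHypothesis.Theorems.SymPencilPerFourJointFamilyTransport

variable {K : Type*} [Field K]

/-! ### (T1″) general pairs, the kernel plane, (B3) the full-row-rank branch `n_r = 4` (memo §6.3) -/

/-- (T1′) for a general pair of live rows. [folklore] -/
theorem common_col_gen [CharZero K] (W : Submodule K (Fin 4 × Fin 4 → K))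
    (h5 : finrank K W = 5) (hrow : ∀ x ∈ W, ∀ j : Fin 4, x (3, j) = 0) (hP : PerDirFour W)
    (p q : Fin 4) (hpq : p ≠ q) (hp : p ≠ 3) (hq : q ≠ 3)
    (hinj : ∀ x ∈ W, (∀ j : Fin 4, x (p, j) = 0) → (∀ j : Fin 4, x (q, j) = 0) → x = 0) :
    ∃ m : Fin 4, ∀ y ∈ W, y (p, m) = 0 ∧ y (q, m) = 0 := by
  have hi4 : ∀ i : Fin 4, i = 0 ∨ i = 1 ∨ i = 2 ∨ i = 3 := by decide
  have swap : ∀ p' q' : Fin 4, (∃ m : Fin 4, ∀ y ∈ W, y (q', m) = 0 ∧ y (p', m) = 0) →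
      ∃ m : Fin 4, ∀ y ∈ W, y (p', m) = 0 ∧ y (q', m) = 0 :=
    fun p' q' ⟨m, hm⟩ => ⟨m, fun y hy => (hm y hy).symm⟩
  rcases hi4 p with rfl | rfl | rfl | rfl <;> rcases hi4 q with rfl | rfl | rfl | rfl <;> first
    | exact absurd rfl hpq
    | exact absurd rfl hp
    | exact absurd rfl hq
    | exact common_col01 W h5 hrow hP hinj
    | exact common_col02 W h5 hrow hP hinj
    | exact common_col12 W h5 hrow hP hinj
    | exact swap _ _ (common_col01 W h5 hrow hP (fun x hx h0 h1 => hinj x hx h1 h0))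
    | exact swap _ _ (common_col02 W h5 hrow hP (fun x hx h0 h1 => hinj x hx h1 h0))
    | exact swap _ _ (common_col12 W h5 hrow hP (fun x hx h0 h1 => hinj x hx h1 h0))

/-- **§6.3 (B3)**: no live row `r` of `W` projects onto `K⁴` (the kernel plane `K_r` would be a
line, so one of the two other live rows has no pure element; then (T1′) kills a column of row `r`,
contradicting surjectivity). [folklore] -/
theorem nr4_false [CharZero K] (W : Submodule K (Fin 4 × Fin 4 → K)) (h5 : finrank K W = 5)
    (hrow : ∀ x ∈ W, ∀ j : Fin 4, x (3, j) = 0) (hP : PerDirFour W)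
    (r s t : Fin 4) (hrs : r ≠ s) (hrt : r ≠ t) (hr3 : r ≠ 3) (hs3 : s ≠ 3) (ht3 : t ≠ 3)
    (hcov : ∀ i : Fin 4, i = r ∨ i = s ∨ i = t ∨ i = 3)
    (hsurj : W.map (rowL (K := K) r) = ⊤) : False := by
  have hk : finrank K (kerPlane W r) = 1 := by
    have h := finrank_kerPlane W r
    rw [hsurj, finrank_top, Module.finrank_fintype_fun_eq_card, Fintype.card_fin] at h
    have h5W : finrank K W = 5 := h5
    omega
  have zero_of : ∀ x ∈ W, (∀ m, x (r, m) = 0) → (∀ m, x (s, m) = 0) → (∀ m, x (t, m) = 0) →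
      x = 0 := by
    intro x hx h1 h2 h3
    ext ⟨i, m⟩
    rw [Pi.zero_apply]
    rcases hcov i with rfl | rfl | rfl | rfl
    · exact h1 m
    · exact h2 m
    · exact h3 m
    · exact hrow x hx m
  have unit_absurd : ∀ p q : Fin 4, (∃ m : Fin 4, ∀ y ∈ W, y (p, m) = 0 ∧ y (q, m) = 0) →
      p = r → False := by
    rintro p q ⟨m, hm⟩ rfl
    have hmem : (Pi.single m (1 : K) : Fin 4 → K) ∈ W.map (rowL (K := K) p) := by
      rw [hsurj]
      exact Submodule.mem_top
    obtain ⟨y, hy, hyr⟩ := hmem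
    have h : y (p, m) = (Pi.single m (1 : K) : Fin 4 → K) m := congr_fun hyr m
    rw [(hm y hy).1, Pi.single_eq_same] at h
    exact zero_ne_one h
  by_cases ha : ∀ a ∈ W, (∀ m, a (r, m) = 0) → (∀ m, a (s, m) = 0) → a = 0
  · exact unit_absurd r s (common_col_gen W h5 hrow hP r s hrs hr3 hs3 ha) rfl
  by_cases hb : ∀ b ∈ W, (∀ m, b (r, m) = 0) → (∀ m, b (t, m) = 0) → b = 0
  · exact unit_absurd r t (common_col_gen W h5 hrow hP r t hrt hr3 ht3 hb) rfl
  push Not at ha hb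
  obtain ⟨a, haW, har, has, hane⟩ := ha
  obtain ⟨b, hbW, hbr, hbt, hbne⟩ := hb
  have haK : a ∈ kerPlane W r := (mem_kerPlane W r a).2 ⟨haW, funext har⟩
  have hbK : b ∈ kerPlane W r := (mem_kerPlane W r b).2 ⟨hbW, funext hbr⟩
  have hane' : (⟨a, haK⟩ : kerPlane W r) ≠ 0 := by
    intro h
    apply hane
    have := congr_arg (fun z : kerPlane W r => (z : Fin 4 × Fin 4 → K)) h
    simpa using this
  obtain ⟨μ, hμ⟩ :=
    (finrank_eq_one_iff_of_nonzero' (K := K) (V := kerPlane W r) _ hane').1 hk ⟨b, hbK⟩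
  have hμ' : μ • a = b := by
    have := congr_arg (fun z : kerPlane W r => (z : Fin 4 × Fin 4 → K)) hμ
    simpa using this
  apply hbne
  refine zero_of b hbW hbr ?_ hbt
  intro m
  rw [← hμ', Pi.smul_apply, has m, smul_zero]

/-- **Mixed polarisation**: if `x, k ∈ W ⊆ Sing` and row `r` of `k` vanishes, then
`T3 (row x r) (row x s) (row k t) + T3 (row x r) (row k s) (row x t) = 0` (the `λ¹`-coefficient … (memo). [folklore] -/
theorem polar₁ [CharZero K] {W : Submodule K (Fin 4 × Fin 4 → K)} (hS : Sing3 W)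
    {r s t : Fin 4} (hrs : r ≠ s) (hrt : r ≠ t) (hst : s ≠ t)
    {x : Fin 4 × Fin 4 → K} (hx : x ∈ W) {k : Fin 4 × Fin 4 → K} (hk : k ∈ W)
    (hkr : row k r = 0) (l : Fin 4) :
    T3 (row x r) (row x s) (row k t) l + T3 (row x r) (row k s) (row x t) l = 0 := by
  have h1 := T3_eq_zero_of_sing3 hS (W.add_mem hx hk) r s t hrs hrt hst l
  have h2 := T3_eq_zero_of_sing3 hS (W.sub_mem hx hk) r s t hrs hrt hst l
  rw [row_add, row_add, row_add, hkr, add_zero] at h1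
  rw [row_sub, row_sub, row_sub, hkr, sub_zero] at h2
  have e1 : T3 (row x r) (row x s + row k s) (row x t + row k t) l =
      T3 (row x r) (row x s) (row x t) l + T3 (row x r) (row x s) (row k t) l +
        T3 (row x r) (row k s) (row x t) l + T3 (row x r) (row k s) (row k t) l := by
    simp only [T3, Pi.add_apply]; ring
  have e2 : T3 (row x r) (row x s - row k s) (row x t - row k t) l =
      T3 (row x r) (row x s) (row x t) l - T3 (row x r) (row x s) (row k t) l -
        T3 (row x r) (row k s) (row x t) l + T3 (row x r) (row k s) (row k t) l := by
    simp only [T3, Pi.sub_apply]; ring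
  have h3 : (2 : K) * (T3 (row x r) (row x s) (row k t) l + T3 (row x r) (row k s) (row x t) l) = 0 := by
    linear_combination h1 - h2 - e1 + e2
  rcases mul_eq_zero.mp h3 with h | h
  · exact absurd h two_ne_zero
  · exact h


/-! ### Leaf R1N from the NARROWED residual (normal form: zero row `3`, no live row of full rank) -/

/-- **Leaf R1N ⇐ its narrowed residual.** Transport the zero row to row `3` (`rowPermL`, `per₄`
invariant ✓ `eval_perPoly_comp_prodCongr`, families by ✓ `sum_sq_swap_map`); a … (memo). [folklore] -/
theorem threeRowsFourCols_of_residual [CharZero K]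
    (hres : ∀ W : Submodule K (Fin 4 × Fin 4 → K), Sing3 W → finrank K W = 5 →
      (∀ x ∈ W, ∀ j : Fin 4, x (3, j) = 0) →
      ¬ (∃ j : Fin 4, ∀ x ∈ W, ∀ i : Fin 4, x (i, j) = 0) →
      ¬ TwoZeroRows W → ¬ InCross W → PerDirFour W →
      (∀ r : Fin 4, W.map (rowL (K := K) r) ≠ ⊤) → False) :
    ∀ W : Submodule K (Fin 4 × Fin 4 → K), Sing3 W → finrank K W = 5 →
      (∃ i : Fin 4, ∀ x ∈ W, ∀ j : Fin 4, x (i, j) = 0) →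
      ¬ (∃ j : Fin 4, ∀ x ∈ W, ∀ i : Fin 4, x (i, j) = 0) →
      ¬ TwoZeroRows W → ¬ InCross W → PerDirFour W → False := by
  intro W hS h5 hrow hncol hn2 hnX hP
  obtain ⟨i, hi⟩ := hrow
  set σ : Equiv.Perm (Fin 4) := Equiv.swap 3 i with hσ
  have hσ3 : σ 3 = i := by rw [hσ, Equiv.swap_apply_left]
  set Φ : (Fin 4 × Fin 4 → K) ≃ₗ[K] (Fin 4 × Fin 4 → K) := rowPermL (K := K) σ with hΦ
  have hΦa : ∀ (x : Fin 4 × Fin 4 → K) (a b : Fin 4), Φ x (a, b) = x (σ a, b) := fun x a b => rfl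
  set W' : Submodule K (Fin 4 × Fin 4 → K) :=
    W.map (Φ : (Fin 4 × Fin 4 → K) →ₗ[K] (Fin 4 × Fin 4 → K)) with hW'
  have hmemΦ : ∀ x ∈ W, (Φ x : Fin 4 × Fin 4 → K) ∈ W' := fun x hx =>
    Submodule.mem_map_of_mem (f := (Φ : (Fin 4 × Fin 4 → K) →ₗ[K] (Fin 4 × Fin 4 → K))) hx
  have hS' : Sing3 W' := sing3_map_rowPermL hS σ
  have h5' : finrank K W' = 5 := by rw [hW', LinearEquiv.finrank_map_eq]; exact h5
  have hrow' : ∀ y ∈ W', ∀ j : Fin 4, y (3, j) = 0 := by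
    rintro _ ⟨x, hx, rfl⟩ j
    show Φ x (3, j) = 0
    rw [hΦa, hσ3]
    exact hi x hx j
  have hncol' : ¬ ∃ j : Fin 4, ∀ y ∈ W', ∀ a : Fin 4, y (a, j) = 0 := by
    rintro ⟨j, hj⟩
    apply hncol
    refine ⟨j, fun x hx a => ?_⟩
    have h := hj (Φ x) (hmemΦ x hx) (σ.symm a)
    rw [hΦa, Equiv.apply_symm_apply] at h
    exact h
  have hn2' : ¬ TwoZeroRows W' := by
    rintro ⟨p, q, hpq, h⟩
    apply hn2
    refine ⟨σ p, σ q, fun e => hpq (σ.injective e), fun x hx j => ?_⟩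
    have h' := h (Φ x) (hmemΦ x hx) j
    rw [hΦa, hΦa] at h'
    exact h'
  have hnX' : ¬ InCross W' := by
    rintro ⟨l, c, h⟩
    apply hnX
    refine ⟨σ l, c, fun x hx a b ha hb => ?_⟩
    have h' := h (Φ x) (hmemΦ x hx) (σ.symm a) b
      (fun e => ha (by rw [← e, Equiv.apply_symm_apply])) hb
    rw [hΦa, Equiv.apply_symm_apply] at h'
    exact h'
  have hP' : PerDirFour W' := by
    rintro _ ⟨x, hx, rfl⟩
    obtain ⟨c, Λ, h⟩ := hP x hx
    exact ⟨c, fun k => (Λ k).comp Φ.symm.toLinearMap,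
      SymPencilPerFourTwoRowCorankTwo.sum_sq_swap_map Φ
        (fun z => SymPencilPerFourBlocks.eval_perPoly_comp_prodCongr σ (Equiv.refl (Fin 4)) z)
        x c Λ h⟩
  by_cases h4 : ∃ r : Fin 4, W'.map (rowL (K := K) r) = ⊤
  · obtain ⟨r, hr⟩ := h4
    have hi4 : ∀ r : Fin 4, r = 0 ∨ r = 1 ∨ r = 2 ∨ r = 3 := by decide
    rcases hi4 r with rfl | rfl | rfl | rfl
    · exact nr4_false W' h5' hrow' hP' 0 1 2 (by decide) (by decide) (by decide) (by decide)
        (by decide) (by decide) hr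
    · exact nr4_false W' h5' hrow' hP' 1 0 2 (by decide) (by decide) (by decide) (by decide)
        (by decide) (by decide) hr
    · exact nr4_false W' h5' hrow' hP' 2 0 1 (by decide) (by decide) (by decide) (by decide)
        (by decide) (by decide) hr
    · have hmem : (Pi.single 0 (1 : K) : Fin 4 → K) ∈ W'.map (rowL (K := K) 3) := by
        rw [hr]; trivial
      obtain ⟨y, hy, hyv⟩ := Submodule.mem_map.mp hmem
      have h1 := congr_fun hyv 0
      simp only [rowL_apply, Pi.single_eq_same] at h1
      have h0 : row y 3 0 = 0 := hrow' y hy 0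
      rw [h0] at h1
      exact zero_ne_one h1
  · push Not at h4
    exact hres W' hS' h5' hrow' hncol' hn2' hnX' hP' h4

end Summit.ValiantsHypothesis.ValiantsHypothesis.Theorems.SymPencilSingFiveClassification
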